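import Summits.RiemannHypothesis.RiemannHypothesis.Theses.SignCone
import Literature.NumberTheory.LFunctions.WeilExplicit
import Literature.NumberTheory.LFunctions.WeilExplicitProofs
import Literature.NumberTheory.LFunctions.WeilExplicitFormulaProofs
import Literature.NumberTheory.LFunctions.WeilMellinInversion
import Literature.NumberTheory.LFunctions.WeilArchimedeanMoments
import Literature.NumberTheory.LFunctions.WeilArchimedeanPositivityProofs
import Literature.NumberTheory.LFunctions.ZetaZerosProofs
import Summits.RiemannHypothesis.RiemannHypothesis.Theorems.SignConeUnitSlackReduction

/-!
# `SignCone.OscCoherentCore` — line `Sketch` (off-line defect ledger)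
(item stmt-RiemannHypothesis-18013, route route-RiemannHypothesis-SignCone)

THE CRUX (#6 of route SignCone): for every cutoff `a > 13/10` and every finite family of Weil tests `gᵢ`
supported in `[-a, a]` whose autocorrelation sum `F = Σᵢ gᵢ ⋆ g̃ᵢ` is non-negative at the nodes `log n`,
whose far-field negativity is NOT confined to one window `[T, T + log 2]` (`T ≥ 3`) but IS present somewhere,
`Re W_ar(F) ≥ -Re F(0)` (`W_ar = weilPolarTerm + weilArchTerm`).

STATUS (kernel-checked before this line opened): `RiemannHypothesis → crux` (refuter Evidence §2 via
p128354); `crux ↔ SignConeInequality ↔ SignConeOscillatory` (`Theorems/SignConeSignConeOscillatoryCoherentCoreCollapse`);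
hence the crux is RH-equivalent given the (open) sibling `SlackDesign` and the closed `SignConeDuality`.
Every composition therefore ends in ONE RH-strength stub; this skeleton isolates it as `stub_offLineMoment`
(held by the lead) and makes every other stub an unconditional, provable statement.

LINE (card `Ideas/offline-defect-cubic-law.md`; first lemmas `Cruxes/OscCoherentCore/SketchIdeatorTwo.lean`).
Write `k = g ⋆ g̃`, `ĝ(ξ) = weilMellin g (1/2 + iξ)`, `k̂(1/2+iξ) = |ĝ(ξ)|² ≥ 0`. For a zero `ρ = 1/2 + δ + iγ`:
* DEFECT (stub_defectLowerBound): `Re k̂(ρ) = |ĝ(γ)|² + ½ D_k(ρ) ≥ -½ |D_k(ρ)|`,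
  `D_k(ρ) := ∫ k(u) (2cosh(δu) - 2) e^{iγu} du` (the kernel `2cosh(δu) - 2 = 4 sinh²(δu/2)` is the exact
  second-order remainder of the tilt; it VANISHES for on-line zeros).
* SPECTRAL FORM (stub_defectSpectral): by Fourier inversion of `k` and `tsupport k ⊆ [-2a, 2a]`,
  `D_k(ρ) = (1/2π) ∫ |ĝ(ξ)|² L̂_{a,δ}(γ - ξ) dξ`, `L̂_{a,δ}(η) = ∫ (2cosh(δu) - 2) χ_a(u) e^{iηu} du` with the `C²`
  piecewise-polynomial cutoff `χ_a(u) = (1 - x³)³`, `x = min 1 (max 0 (|u| - 2a))` (`= 1` on `[-2a, 2a]`,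
  `= 0` off `[-2a-1, 2a+1]`).
* KERNEL BOUND (stub_cutoffKernelBound): `|L̂_{a,δ}(η)| ≤ δ² E(a)/(1 + η²)`, `E(a) = 200 (2a+1)³ cosh(a + 1/2)`
  (two integrations by parts; `|δ| ≤ 1/2`, `a ≥ 1`).
* WINDOW SUM (stub_windowSum): if every height window of half-width `1/a` carries off-line second moment
  `Σ m(ρ) δ_ρ² ≤ κ`, then `Σ_{ρ ∈ weilZeroIndex T} m(ρ) δ_ρ² /(1 + (γ_ρ - ξ)²) ≤ κ (4a + 4)` for all `ξ, T`.
* TRANSFER (stub_transfer, lead): the four items above + Plancherel (`∫|ĝ|² = 2π‖g‖₂²`) + the explicit formula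
  (`explicit_formula_holds`) give unit-slack Weil positivity `-‖g‖₂² ≤ Re W(g ⋆ g̃)` at cutoff `a` from the
  window law with `κ(a) = 1/(2 E(a)(a + 1))`; the landed `neg_re_apply_zero_le_re_weilArchPolar_of_fakeWeight_unitSlack`
  (c = Λ, node signs enter once through `P_Λ(F) ≥ 0`) turns it into the crux body at cutoff `a`.
* TERMINAL (stub_offLineMoment, RH-strength, held by the lead): the WINDOWED OFF-LINE SECOND-MOMENT LAW at every
  cutoff `a > 13/10` with constant `κ(a)`. RH-implied (vacuously: `offLineMoment_of_riemannHypothesis` below) and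
  RH-equivalent over all cutoffs (`stub_riemannHypothesis_of_offLineMoment`): exactly as hard as the crux.

Dictionary (verbatim expansions, no local `def`):
* `χ_a(u)`      ↦ `(1 - (min 1 (max 0 (|u| - 2 * a))) ^ 3) ^ 3`
* `K_δ(u)`      ↦ `2 * Real.cosh (δ * u) - 2`
* `L̂_{a,δ}(η)` ↦ `∫ u : ℝ, (((2 * Real.cosh (δ * u) - 2) * (1 - (min 1 (max 0 (|u| - 2 * a))) ^ 3) ^ 3 : ℝ) : ℂ) * cexp (↑(η * u) * I)`
* `κ(a)`        ↦ `1 / (400 * (2 * a + 1) ^ 3 * Real.cosh (a + 1 / 2) * (a + 1))`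
* window law    ↦ `∀ (t : ℝ) (S : Finset ℂ), (∀ ρ ∈ S, riemannZeta ρ = 0 ∧ 0 ≤ ρ.re ∧ ρ.re ≤ 1 ∧ ρ.im ≠ 0 ∧ |ρ.im - t| ≤ 1 / a) →
                    ∑ ρ ∈ S, (riemannZetaZeroOrder ρ : ℝ) * (ρ.re - 1 / 2) ^ 2 ≤ κ`
-/

noncomputable section

-- `Summit.RiemannHypothesis.RiemannHypothesis.…` repeats a namespace component by design (D-0017 layout).
set_option linter.dupNamespace false

open scoped BigOperators ComplexConjugate Real
open Complex MeasureTheory Set Filter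

namespace Summit.RiemannHypothesis.RiemannHypothesis.Theorems.OscCoherentCore

open Literature.NumberTheory.LFunctions
open Summit.RiemannHypothesis.RiemannHypothesis.Theorems.SignCone

/-! ### Stubs -/

/-- STUB A (defect lower bound). For a Weil test `g`, `k = g ⋆ g̃` and any `ρ`,
`Re k̂(ρ) ≥ -½ |D_k(ρ)|` with `D_k(ρ) = ∫ k(u)(2cosh(δu) - 2)e^{iγu} du`, `δ = Re ρ - 1/2`, `γ = Im ρ`:
indeed `conj k̂(ρ) = k̂(1 - conj ρ)` (`conj_weilMellin_of_selfAdjoint`), so `2 Re k̂(ρ) = ∫ k (e^{δu} + e^{-δu}) e^{iγu}`,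
and `k̂(1/2 + iγ) = |ĝ(1/2+iγ)|² ≥ 0` (`weilMellin_weilQuadratic_of_re_eq`). [folklore] -/
theorem stub_defectLowerBound :
    ∀ g : ℝ → ℂ, IsWeilTest g → ∀ ρ : ℂ,
      -(1 / 2 : ℝ) * ‖∫ u : ℝ, weilConv g (weilReflect g) u *
          ((2 * Real.cosh ((ρ.re - 1 / 2) * u) - 2 : ℝ) : ℂ) * cexp (↑(ρ.im * u) * I)‖ ≤
        (weilMellin (weilConv g (weilReflect g)) ρ).re := by
  sorry

/-- STUB B (spectral form of the defect). For a Weil test `g` supported in `[-a, a]`, `k = g ⋆ g̃`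
(so `tsupport k ⊆ [-2a, 2a]`, where the cutoff `χ_a = 1`), Fourier inversion
`2π k(u) = ∫ k̂(1/2 + iξ) e^{-iξu} dξ` (`weilMellin_inversion`), `k̂(1/2+iξ) = |ĝ(1/2+iξ)|²` and Fubini give
`D_k = (1/2π) ∫ |ĝ|² · L̂_{a,δ}(γ - ·)`. [folklore] -/
theorem stub_defectSpectral :
    ∀ a : ℝ, 0 < a → ∀ g : ℝ → ℂ, IsWeilTest g → tsupport g ⊆ Icc (-a) a → ∀ δ γ : ℝ,
      (∫ u : ℝ, weilConv g (weilReflect g) u * ((2 * Real.cosh (δ * u) - 2 : ℝ) : ℂ) * cexp (↑(γ * u) * I)) =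
        (1 / (2 * π) : ℂ) * ∫ ξ : ℝ, ((‖weilMellin g (1 / 2 + ξ * I)‖ ^ 2 : ℝ) : ℂ) *
          ∫ u : ℝ, (((2 * Real.cosh (δ * u) - 2) * (1 - (min 1 (max 0 (|u| - 2 * a))) ^ 3) ^ 3 : ℝ) : ℂ) *
            cexp (↑((γ - ξ) * u) * I) := by
  sorry

/-- STUB C (Fourier bound for the cut-off defect kernel). For `a ≥ 1`, `|δ| ≤ 1/2` and every real `η`,
`|L̂_{a,δ}(η)| ≤ δ² · 200 (2a+1)³ cosh(a + 1/2) / (1 + η²)`: `L = K_δ χ_a` is `C²`, supported in `|u| ≤ 2a + 1`,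
with `|K_δ| ≤ δ²u² cosh(δu)`, `|K_δ'| ≤ 2δ²|u| cosh(δu)`, `|K_δ''| ≤ 2δ² cosh(δu)`; bound `|L̂| ≤ ‖L‖₁` and, after
two integrations by parts, `|L̂| ≤ ‖L''‖₁/η²`. [folklore] -/
theorem stub_cutoffKernelBound :
    ∀ a : ℝ, 1 ≤ a → ∀ δ : ℝ, |δ| ≤ 1 / 2 → ∀ η : ℝ,
      ‖∫ u : ℝ, (((2 * Real.cosh (δ * u) - 2) * (1 - (min 1 (max 0 (|u| - 2 * a))) ^ 3) ^ 3 : ℝ) : ℂ) *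
          cexp (↑(η * u) * I)‖ ≤
        δ ^ 2 * (200 * (2 * a + 1) ^ 3 * Real.cosh (a + 1 / 2)) / (1 + η ^ 2) := by
  sorry

/-- STUB D (window bookkeeping). If every height window `|Im ρ - t| ≤ 1/a` carries weighted off-line second
moment `Σ m(ρ)(Re ρ - 1/2)² ≤ κ` (zeros of `ζ` with `0 ≤ Re ρ ≤ 1`, `Im ρ ≠ 0`, each listed once), then for
every `ξ` and `T` the Cauchy-weighted sum over the truncated zero index is at most `κ (4a + 4)`: cover
`weilZeroIndex T` (finite) by the windows centred at `ξ + 2j/a`, `j ∈ ℤ`, on which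
`1/(1 + (Im ρ - ξ)²) ≤ min(1, a²/j²)` (`j ≠ 0`), and `1 + 2 Σ_{j ≥ 1} min(1, a²/j²) ≤ 1 + 2(2a + 1) ≤ 4a + 4`. [folklore] -/
theorem stub_windowSum :
    ∀ a κ : ℝ, 1 ≤ a → 0 ≤ κ →
      (∀ (t : ℝ) (S : Finset ℂ),
        (∀ ρ ∈ S, riemannZeta ρ = 0 ∧ 0 ≤ ρ.re ∧ ρ.re ≤ 1 ∧ ρ.im ≠ 0 ∧ |ρ.im - t| ≤ 1 / a) →
        ∑ ρ ∈ S, (riemannZetaZeroOrder ρ : ℝ) * (ρ.re - 1 / 2) ^ 2 ≤ κ) →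
      ∀ ξ T : ℝ, ∑ᶠ ρ ∈ weilZeroIndex T,
        (riemannZetaZeroOrder ρ : ℝ) * (ρ.re - 1 / 2) ^ 2 / (1 + (ρ.im - ξ) ^ 2) ≤ κ * (4 * a + 4) := by
  sorry

/-- STUB E (transfer; held by the lead, proved from stubs A–D). The windowed off-line second-moment law at
cutoff `a ≥ 1` with constant `κ(a) = 1/(400 (2a+1)³ cosh(a+1/2) (a+1))` gives UNIT-SLACK WEIL POSITIVITY at
cutoff `a`: `-‖g‖₂² ≤ Re W(g ⋆ g̃)` for every Weil test `g` supported in `[-a, a]`. Proof: by the explicit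
formula `W(g ⋆ g̃) = lim_T Σ_{ρ ∈ weilZeroIndex T} m(ρ) k̂(ρ)`; each term has `Re ≥ -½ m(ρ)|D_k(ρ)|` (A);
`|D_k(ρ)| ≤ (1/2π)∫|ĝ|² δ_ρ² E(a)/(1 + (γ_ρ - ξ)²) dξ` (B, C); summing with (D) and Plancherel
`∫|ĝ(1/2+iξ)|² dξ = 2π‖g‖₂²` gives `Re Σ ≥ -½ · E(a) κ(a) (4a+4) ‖g‖₂² = -‖g‖₂²`. [folklore] -/
theorem stub_transfer :
    ∀ a : ℝ, 1 ≤ a →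
      (∀ (t : ℝ) (S : Finset ℂ),
        (∀ ρ ∈ S, riemannZeta ρ = 0 ∧ 0 ≤ ρ.re ∧ ρ.re ≤ 1 ∧ ρ.im ≠ 0 ∧ |ρ.im - t| ≤ 1 / a) →
        ∑ ρ ∈ S, (riemannZetaZeroOrder ρ : ℝ) * (ρ.re - 1 / 2) ^ 2 ≤
          1 / (400 * (2 * a + 1) ^ 3 * Real.cosh (a + 1 / 2) * (a + 1))) →
      ∀ g : ℝ → ℂ, IsWeilTest g → tsupport g ⊆ Icc (-a) a →
        -(∫ t : ℝ, ‖g t‖ ^ 2) ≤ (weilQuadratic g).re := by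
  have hA := stub_defectLowerBound
  have hB := stub_defectSpectral
  have hC := stub_cutoffKernelBound
  have hD := stub_windowSum
  sorry

/-- TERMINAL STUB (RH-strength; held by the lead). THE WINDOWED OFF-LINE SECOND-MOMENT LAW: at every cutoff
`a > 13/10`, every height window of half-width `1/a` carries multiplicity-weighted off-line depth
`Σ m(ρ) (Re ρ - 1/2)² ≤ κ(a) = 1/(400 (2a+1)³ cosh(a+1/2) (a+1))` (zeros of `ζ` with `0 ≤ Re ρ ≤ 1`, `Im ρ ≠ 0` —
the index set of the explicit formula; on-line zeros contribute `0`). TRUE under RH (vacuously,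
`offLineMoment_of_riemannHypothesis`); over all cutoffs it is EQUIVALENT to RH
(`stub_riemannHypothesis_of_offLineMoment`), and at each fixed cutoff strictly weaker than RH but beyond every
unconditional zero-density / zero-free-region technique (it is an `L^∞`-in-height statement about short
windows). It implies the crux at cutoff `a` by `stub_transfer`. -/
theorem stub_offLineMoment :
    ∀ a : ℝ, 13 / 10 < a → ∀ (t : ℝ) (S : Finset ℂ),
      (∀ ρ ∈ S, riemannZeta ρ = 0 ∧ 0 ≤ ρ.re ∧ ρ.re ≤ 1 ∧ ρ.im ≠ 0 ∧ |ρ.im - t| ≤ 1 / a) →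
      ∑ ρ ∈ S, (riemannZetaZeroOrder ρ : ℝ) * (ρ.re - 1 / 2) ^ 2 ≤
        1 / (400 * (2 * a + 1) ^ 3 * Real.cosh (a + 1 / 2) * (a + 1)) := by
  sorry

/-- STUB F (honesty check: the terminal stub is RH-equivalent over all cutoffs). If the windowed off-line
second-moment law holds at every cutoff `a > 13/10` then RH: a zero `ρ` of `ζ` that is neither trivial nor `1`
has `Im ρ ≠ 0` (no real zeros in `[0, 1)`: `riemannZeta_ne_zero_of_im_eq_zero_of_pos_of_lt_one`,
`riemannZeta_eq_zero_iff_of_re_nonpos`, `riemannZeta_ne_zero_of_one_le_re`), hence `0 < Re ρ < 1`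
(`re_mem_Ioo_of_riemannZeta_eq_zero_of_im_ne_zero`) and `m(ρ) ≥ 1` (`riemannZetaZeroOrder_pos_iff`); the law
at `t = Im ρ`, `S = {ρ}` gives `(Re ρ - 1/2)² ≤ κ(a) ≤ 1/a` for every `a > 13/10`, so `Re ρ = 1/2`. [folklore] -/
theorem stub_riemannHypothesis_of_offLineMoment :
    (∀ a : ℝ, 13 / 10 < a → ∀ (t : ℝ) (S : Finset ℂ),
      (∀ ρ ∈ S, riemannZeta ρ = 0 ∧ 0 ≤ ρ.re ∧ ρ.re ≤ 1 ∧ ρ.im ≠ 0 ∧ |ρ.im - t| ≤ 1 / a) →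
      ∑ ρ ∈ S, (riemannZetaZeroOrder ρ : ℝ) * (ρ.re - 1 / 2) ^ 2 ≤
        1 / (400 * (2 * a + 1) ^ 3 * Real.cosh (a + 1 / 2) * (a + 1))) →
    RiemannHypothesis := by
  sorry

/-! ### The RH-envelope of the terminal stub (proved) -/

/-- Under RH the windowed off-line second-moment law holds at every cutoff with every non-negative constant:
each indexed zero has `Im ρ ≠ 0`, hence is non-trivial and `≠ 1`, so `Re ρ = 1/2` and its term vanishes.
[folklore] -/
theorem offLineMoment_of_riemannHypothesis (hRH : RiemannHypothesis) {a κ : ℝ} (hκ : 0 ≤ κ) :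
    ∀ (t : ℝ) (S : Finset ℂ),
      (∀ ρ ∈ S, riemannZeta ρ = 0 ∧ 0 ≤ ρ.re ∧ ρ.re ≤ 1 ∧ ρ.im ≠ 0 ∧ |ρ.im - t| ≤ 1 / a) →
      ∑ ρ ∈ S, (riemannZetaZeroOrder ρ : ℝ) * (ρ.re - 1 / 2) ^ 2 ≤ κ := by
  intro t S hS
  have hS0 : ∀ ρ ∈ S, (riemannZetaZeroOrder ρ : ℝ) * (ρ.re - 1 / 2) ^ 2 = 0 := by
    intro ρ hρ
    obtain ⟨hz, -, -, him, -⟩ := hS ρ hρ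
    have hne : ρ ≠ 1 := by
      rintro rfl
      simp at him
    have hre : ρ.re = 1 / 2 := by
      refine hRH ρ hz ?_ hne
      rintro ⟨n, rfl⟩
      simp at him
    rw [hre, sub_self]
    ring
  rw [Finset.sum_eq_zero hS0]
  exact hκ

/-! ### The composition -/

open Summit.RiemannHypothesis.RiemannHypothesis.Theses.SignCone in
/-- **The crux by name.** `OscCoherentCore` from the terminal stub: at cutoff `a > 13/10` the windowed off-line
second-moment law (`stub_offLineMoment`) gives unit-slack Weil positivity on the cone of tests supported in
`[-a, a]` (`stub_transfer`), and the landed unit-slack reduction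
`neg_re_apply_zero_le_re_weilArchPolar_of_fakeWeight_unitSlack` with the TRUE prime weight `c = Λ` (node signs
enter exactly once, through `P_Λ(F) ≥ 0`) yields `-Re F(0) ≤ Re W_ar(F)`. The oscillation and the
not-a-single-window hypotheses of the item are not used (they carry no content: the core is the whole crux,
`Theorems/SignConeSignConeOscillatoryCoherentCoreCollapse`). CLOSED MODULO `{stub_offLineMoment}` once stubs A–F land. -/
theorem OscCoherentCore_of : OscCoherentCore := by
  intro a ha ha' k g hg F hn _hwin _hosc M
  show -(F 0).re ≤ (weilPolarTerm F + weilArchTerm F).re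
  have ha1 : (1 : ℝ) ≤ a := by linarith
  have hW := stub_transfer a ha1 (fun t S hS => stub_offLineMoment a ha' t S hS)
  refine neg_re_apply_zero_le_re_weilArchPolar_of_fakeWeight_unitSlack (b := a)
    (c := fun n => ArithmeticFunction.vonMangoldt n) (fun _ => ArithmeticFunction.vonMangoldt_nonneg)
    (fun g' hg' hs' => ?_) (g := g) (F := F) rfl (fun i => (hg i).1) (fun i => (hg i).2) hn
  have e : weilPolarTerm (weilConv g' (weilReflect g')) + weilArchTerm (weilConv g' (weilReflect g')) -
      ∑' n : ℕ, ((ArithmeticFunction.vonMangoldt n : ℝ) : ℂ) / (Real.sqrt n : ℂ) *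
        (weilConv g' (weilReflect g') (Real.log n) + weilConv g' (weilReflect g') (-Real.log n)) =
      weilQuadratic g' := by
    unfold weilQuadratic weilFunctional weilPrimeTerm
    ring
  rw [e]
  exact hW g' hg' hs'

open Summit.RiemannHypothesis.RiemannHypothesis.Theses.SignCone in
/-- The RH-sandwich of the line: `RiemannHypothesis → OscCoherentCore` through THIS skeleton (terminal stub
discharged by `offLineMoment_of_riemannHypothesis`, the rest unconditional). [folklore] -/
theorem oscCoherentCore_of_riemannHypothesis_via_line (hRH : RiemannHypothesis) : OscCoherentCore := by
  intro a ha ha' k g hg F hn _hwin _hosc M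
  show -(F 0).re ≤ (weilPolarTerm F + weilArchTerm F).re
  have ha1 : (1 : ℝ) ≤ a := by linarith
  have hκ : (0 : ℝ) ≤ 1 / (400 * (2 * a + 1) ^ 3 * Real.cosh (a + 1 / 2) * (a + 1)) := by
    have : 0 < Real.cosh (a + 1 / 2) := Real.cosh_pos _
    positivity
  have hW := stub_transfer a ha1 (offLineMoment_of_riemannHypothesis hRH hκ)
  refine neg_re_apply_zero_le_re_weilArchPolar_of_fakeWeight_unitSlack (b := a)
    (c := fun n => ArithmeticFunction.vonMangoldt n) (fun _ => ArithmeticFunction.vonMangoldt_nonneg)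
    (fun g' hg' hs' => ?_) (g := g) (F := F) rfl (fun i => (hg i).1) (fun i => (hg i).2) hn
  have e : weilPolarTerm (weilConv g' (weilReflect g')) + weilArchTerm (weilConv g' (weilReflect g')) -
      ∑' n : ℕ, ((ArithmeticFunction.vonMangoldt n : ℝ) : ℂ) / (Real.sqrt n : ℂ) *
        (weilConv g' (weilReflect g') (Real.log n) + weilConv g' (weilReflect g') (-Real.log n)) =
      weilQuadratic g' := by
    unfold weilQuadratic weilFunctional weilPrimeTerm
    ring
  rw [e]
  exact hW g' hg' hs'

end Summit.RiemannHypothesis.RiemannHypothesis.Theorems.OscCoherentCore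

end
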